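import Summits.NavierStokesRegularity.FunctionalMining.PalinstrophyRates
import Summits.NavierStokesRegularity.FunctionalMining.PalinstrophyWitness
import Summits.NavierStokesRegularity.FunctionalMining.MonomialBudgetRefutation
import HarnessLib

/-!
# Functional mining, NO-GO #3: no monomial palinstrophy budget `K^a ℰ^b D^e` of degree `< 5`

Search for candidate a priori estimates; no regularity claim.

Cell `pub-nsfunc` (host summit NavierStokesRegularity, topic `FunctionalMining`), NO-GO branch,
dictionary family D7 (palinstrophy `𝒫 = ½‖Δu‖₂²`, Navier–Stokes degree `3`; the known law is the
Doering–Gibbon ladder estimate `d𝒫/dt ≲ ν^{-1/3} 𝒫^{5/3}`, degree `5`; the Grönwall-closable shape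
`𝒫 · 𝒫^{1/3}` has degree `4`). Sieve 1 (`Sieves.lean`) for `𝒫`, kernel-checked: for ALL real
`a, b, e` with `b − a + 3e < 5` and every `C(ν)` the candidate
`d𝒫/dt ≤ C(ν) K^a ℰ^b D^e` (`D = ∫‖Δu‖² = 2𝒫`) fails along some zero-mean classical solution of
unforced Navier–Stokes on `T³` (`not_isRateBudget_palinstrophy_monomial`, and the `e = 0`
sub-class `not_isRateBudget_palinstrophy_monomial_KE`). Ingredients:
* second-order scaling and transfer of the planted field `y ↦ c U(c(y − q))`
  (`production2_plant`, `gradNormSq_laplacian_plant`: degree `5`; `production2_periodize`,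
  `gradNormSq_laplacian_periodize`; `planted_facts2`), on top of `QuadraticBudgetPlanting` /
  `MonomialBudgetRefutation` (`K`, `ℰ`, `D` data of the same family);
* the seed `U` of `PalinstrophyWitness.lean` (`−σ₂(U) > 0`), the ray reduction
  `palinstrophy_rate_ray_le_budget` (`PalinstrophyRates.lean`) at amplitude
  `t₀ = (‖∇ΔU‖₂² + 1)/(−σ₂(U))`: rate `t₀² c⁵` against budget `M c^{b−a+3e}`, and
  `exponent_le_of_forall_nat_mul_rpow_le`.
No definitions.
-/

noncomputable section

open MeasureTheory Set Filter Topology InnerProductSpace Metric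
open scoped RealInnerProductSpace Laplacian ContDiff

namespace Summit.NavierStokesRegularity.FunctionalMining

open Literature.Analysis.FunctionSpaces Literature.Analysis.FluidPDE

/-! ## Scaling of the second-order functionals under concentration -/

section Scaling

variable {U : EuclideanSpace ℝ (Fin 3) → EuclideanSpace ℝ (Fin 3)} {c : ℝ}

/-- `Δ[c U(c(· + a))] = y ↦ c³ (ΔU)(c (y + a))` as functions. [folklore] -/
theorem laplacian_plant_fun (U : EuclideanSpace ℝ (Fin 3) → EuclideanSpace ℝ (Fin 3)) (hc : c ≠ 0)
    (a : EuclideanSpace ℝ (Fin 3)) :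
    Δ (fun y => c • U (c • (y + a))) = fun y => (c * c ^ 2) • Δ U (c • (y + a)) :=
  funext fun y => laplacian_plant U hc a y

/-- `Δ²[c U(c(· + a))](y) = c⁵ (Δ²U)(c (y + a))`. [folklore] -/
theorem laplacian_laplacian_plant (U : EuclideanSpace ℝ (Fin 3) → EuclideanSpace ℝ (Fin 3))
    (hc : c ≠ 0) (a y : EuclideanSpace ℝ (Fin 3)) :
    Δ (Δ (fun y => c • U (c • (y + a)))) y = (c * c ^ 2 * c ^ 2) • Δ (Δ U) (c • (y + a)) := by
  rw [laplacian_plant_fun U hc a,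
    Torus.laplacian_comp_add_right (fun w => (c * c ^ 2) • Δ U (c • w)) a y,
    laplacian_const_smul_comp_smul (Δ U) (c * c ^ 2) hc]

/-- `D(Δ[c U(c(· + a))])(y) = c⁴ D(ΔU)(c (y + a))`. [folklore] -/
theorem fderiv_laplacian_plant (U : EuclideanSpace ℝ (Fin 3) → EuclideanSpace ℝ (Fin 3))
    (hc : c ≠ 0) (a y : EuclideanSpace ℝ (Fin 3)) :
    fderiv ℝ (Δ (fun y => c • U (c • (y + a)))) y = (c * c ^ 2 * c) • fderiv ℝ (Δ U) (c • (y + a)) := by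
  rw [laplacian_plant_fun U hc a,
    fderiv_comp_add_right (f := fun w => (c * c ^ 2) • Δ U (c • w)) a,
    fderiv_const_smul_comp_smul (Δ U) (c * c ^ 2) hc]

/-- **`σ₂` scales like `c⁵`**: `∫⟪(g·∇)g, Δ²g⟫ = c⁵ ∫⟪(U·∇)U, Δ²U⟫` for `g = c U(c(·+a))`
(Navier–Stokes degree `5 = s_𝒫 + 2`). [folklore] -/
theorem production2_plant (U : EuclideanSpace ℝ (Fin 3) → EuclideanSpace ℝ (Fin 3)) (hc : 0 < c)
    (a : EuclideanSpace ℝ (Fin 3)) :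
    (∫ y, ⟪fderiv ℝ (fun y => c • U (c • (y + a))) y (c • U (c • (y + a))),
        Δ (Δ (fun y => c • U (c • (y + a)))) y⟫) =
      c ^ 5 * ∫ z, ⟪fderiv ℝ U z (U z), Δ (Δ U) z⟫ := by
  have hpt : ∀ y, ⟪fderiv ℝ (fun y => c • U (c • (y + a))) y (c • U (c • (y + a))),
      Δ (Δ (fun y => c • U (c • (y + a)))) y⟫ =
      c ^ 8 * (fun z => ⟪fderiv ℝ U z (U z), Δ (Δ U) z⟫) (c • (y + a)) := fun y => by
    rw [fderiv_plant U hc.ne' a y, laplacian_laplacian_plant U hc.ne' a y]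
    simp only [smul_apply, map_smul, real_inner_smul_left, real_inner_smul_right]
    ring
  rw [integral_congr_ae (ae_of_all _ hpt), integral_const_mul,
    integral_comp_plant (fun z => ⟪fderiv ℝ U z (U z), Δ (Δ U) z⟫) hc a, ← mul_assoc]
  congr 1
  field_simp

/-- **The squared gradient norm of the Laplacian scales like `c⁵`.** [folklore] -/
theorem gradNormSq_laplacian_plant (U : EuclideanSpace ℝ (Fin 3) → EuclideanSpace ℝ (Fin 3))
    (hc : 0 < c) (a : EuclideanSpace ℝ (Fin 3)) :
    (∫ y, ∑ i, ‖fderiv ℝ (Δ (fun y => c • U (c • (y + a)))) y (EuclideanSpace.single i 1)‖ ^ 2) =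
      c ^ 5 * ∫ z, ∑ i, ‖fderiv ℝ (Δ U) z (EuclideanSpace.single i 1)‖ ^ 2 := by
  have hpt : ∀ y,
      (∑ i, ‖fderiv ℝ (Δ (fun y => c • U (c • (y + a)))) y (EuclideanSpace.single i 1)‖ ^ 2) =
      c ^ 8 * (fun z => ∑ i, ‖fderiv ℝ (Δ U) z (EuclideanSpace.single i 1)‖ ^ 2) (c • (y + a)) :=
    fun y => by
    rw [fderiv_laplacian_plant U hc.ne' a y]
    simp only [smul_apply, norm_smul, mul_pow, Real.norm_eq_abs, Finset.mul_sum]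
    refine Finset.sum_congr rfl fun i _ => ?_
    rw [show |c * c ^ 2 * c| = c ^ 4 by
      rw [abs_of_pos (by positivity)]; ring]
    ring
  rw [integral_congr_ae (ae_of_all _ hpt), integral_const_mul,
    integral_comp_plant (fun z => ∑ i, ‖fderiv ℝ (Δ U) z (EuclideanSpace.single i 1)‖ ^ 2) hc a,
    ← mul_assoc]
  congr 1
  field_simp

end Scaling

/-! ## Transfer of the second-order functionals through the periodisation -/

section Transfer

variable {g : EuclideanSpace ℝ (Fin 3) → EuclideanSpace ℝ (Fin 3)}

/-- The torus Laplacian of the periodisation is the periodisation of the Laplacian (for `g`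
supported in the open unit cube). [folklore] -/
theorem laplacian_periodize_fun (hg : ContDiff ℝ ∞ g)
    (hgs : tsupport g ⊆ {y | ∀ i, y i ∈ Set.Ioo (0 : ℝ) 1}) :
    Torus.laplacian (Torus.periodize g) = Torus.periodize (Δ g) := by
  funext x
  rw [Torus.laplacian_periodize' (hg.of_le (WithTop.coe_le_coe.mpr le_top))
    (Torus.tsupport_subset_closedBall_of_openCube hgs) x, Torus.periodize_apply]

/-- The Laplacian of a field supported in the open unit cube is smooth and supported there.
[folklore] -/
theorem laplacian_cube (hg : ContDiff ℝ ∞ g) (hgs : tsupport g ⊆ {y | ∀ i, y i ∈ Set.Ioo (0 : ℝ) 1}) :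
    ContDiff ℝ ∞ (Δ g) ∧ tsupport (Δ g) ⊆ {y | ∀ i, y i ∈ Set.Ioo (0 : ℝ) 1} :=
  ⟨BumpWitness.contDiff_laplacian_of_smooth hg,
    (closure_minimal (fun y hy => by by_contra h; exact hy (laplacian_eq_zero_of_notMem_tsupport h))
      (isClosed_tsupport g)).trans hgs⟩

/-- **Planting: the bi-Laplacian production.** `∫_{T³}⟪(w·∇)w, Δ²w⟫ = ∫_{ℝ³}⟪(g·∇)g, Δ²g⟫` for
`w = periodize g`. [folklore] -/
theorem production2_periodize (hg : ContDiff ℝ ∞ g)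
    (hgs : tsupport g ⊆ {y | ∀ i, y i ∈ Set.Ioo (0 : ℝ) 1}) :
    (∫ x, ⟪Torus.convect (Torus.periodize g) (Torus.periodize g) x,
        Torus.laplacian (Torus.laplacian (Torus.periodize g)) x⟫) =
      ∫ y, ⟪fderiv ℝ g y (g y), Δ (Δ g) y⟫ := by
  obtain ⟨h0, h1, -⟩ := eq_zero_off_cube hgs
  obtain ⟨hΔg, hΔgs⟩ := laplacian_cube hg hgs
  obtain ⟨-, -, h2⟩ := eq_zero_off_cube hΔgs
  have hR := Torus.tsupport_subset_closedBall_of_openCube hgs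
  have hRΔ := Torus.tsupport_subset_closedBall_of_openCube hΔgs
  rw [laplacian_periodize_fun hg hgs]
  refine Torus.integral_eq_integral_of_forall_proj_eq (fun y hy => ?_) fun y hy => ?_
  · simp only [Torus.convect]
    rw [Torus.fderiv_periodize (hg.of_le (by exact_mod_cast le_top)) hR,
      Torus.laplacian_periodize (hΔg.of_le (WithTop.coe_le_coe.mpr le_top)) hRΔ, Torus.periodize_proj,
      Torus.perSum_eq_self_of_mem_unitCube h0 hy, Torus.perSum_eq_self_of_mem_unitCube h1 hy,
      Torus.perSum_eq_self_of_mem_unitCube h2 hy]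
  · have hy' : ¬ ∀ i, y i ∈ Set.Ioo (0 : ℝ) 1 := fun h => hy fun i => Set.Ioo_subset_Ico_self (h i)
    simp [h0 y hy']

/-- **Planting: the squared gradient norm of the Laplacian.**
`‖∇Δ(periodize g)‖₂² = ∫_{ℝ³} Σᵢ ‖∂ᵢΔg‖²`. [folklore] -/
theorem gradNormSq_laplacian_periodize (hg : ContDiff ℝ ∞ g)
    (hgs : tsupport g ⊆ {y | ∀ i, y i ∈ Set.Ioo (0 : ℝ) 1}) :
    Torus.gradNormSq (Torus.laplacian (Torus.periodize g)) =
      ∫ y, ∑ i, ‖fderiv ℝ (Δ g) y (EuclideanSpace.single i 1)‖ ^ 2 := by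
  obtain ⟨hΔg, hΔgs⟩ := laplacian_cube hg hgs
  have h := torusEnstrophy_periodize hΔg hΔgs
  rw [laplacian_periodize_fun hg hgs, gradNormSq_eq_two_mul_torusEnstrophy, h]
  ring

end Transfer

/-! ## The planted family member, second-order data -/

/-- Second-order data of the planted field at scale `c ≥ 8`: bi-Laplacian production `c⁵ σ₂(U)`
and `‖∇Δ·‖₂² = c⁵ ∫ Σᵢ‖∂ᵢΔU‖²`. [folklore] -/
theorem planted_facts2 {U : EuclideanSpace ℝ (Fin 3) → EuclideanSpace ℝ (Fin 3)}
    (hU : ContDiff ℝ ∞ U) (hUs : tsupport U ⊆ Metric.closedBall 0 2)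
    {q : EuclideanSpace ℝ (Fin 3)} (hq : ∀ i, q i = 1 / 2) {c : ℝ} (hc : 8 ≤ c) :
    (∫ x, ⟪Torus.convect (Torus.periodize fun y => c • U (c • (y + -q)))
        (Torus.periodize fun y => c • U (c • (y + -q))) x,
        Torus.laplacian (Torus.laplacian (Torus.periodize fun y => c • U (c • (y + -q)))) x⟫) =
      c ^ 5 * ∫ z, ⟪fderiv ℝ U z (U z), Δ (Δ U) z⟫ ∧
    Torus.gradNormSq (Torus.laplacian (Torus.periodize fun y => c • U (c • (y + -q)))) =
      c ^ 5 * ∫ z, ∑ i, ‖fderiv ℝ (Δ U) z (EuclideanSpace.single i 1)‖ ^ 2 := by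
  have hc0 : 0 < c := by linarith
  have hg : ContDiff ℝ ∞ (fun y => c • U (c • (y + -q))) := contDiff_plant hU c (-q)
  have hgs : tsupport (fun y => c • U (c • (y + -q))) ⊆ {y | ∀ i, y i ∈ Set.Ioo (0 : ℝ) 1} := by
    intro y hy
    have h1 := tsupport_plant hc0 hUs (-q) hy
    rw [neg_neg, Metric.mem_closedBall, dist_eq_norm] at h1
    have h2 : ‖y - q‖ < 1 / 2 := by
      have : 2 / c ≤ 1 / 4 := by
        rw [div_le_iff₀ hc0]; linarith
      linarith
    simpa using (Torus.add_mem_unitCube_of_norm_lt hq h2).2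
  exact ⟨by rw [production2_periodize hg hgs, production2_plant U hc0 (-q)],
    by rw [gradNormSq_laplacian_periodize hg hgs, gradNormSq_laplacian_plant U hc0 (-q)]⟩

/-! ## NO-GO #3: Sieve 1 for the palinstrophy, monomial class -/

/-- **NO-GO #3 (Sieve 1 for the palinstrophy, monomial class, kernel-checked).** For all real
exponents `a, b, e` with `b − a + 3e < 5` and every viscosity-dependent constant `C(ν)`, the
candidate budget
`d/dt ½‖Δu‖₂² ≤ C(ν) · K^a · ℰ^b · D^e` (`K = ½‖u‖₂²`, `ℰ = ½‖∇u‖₂²`, `D = ∫‖Δu‖² = 2𝒫`)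
FAILS along some zero-mean classical solution of unforced Navier–Stokes on the unit 3-torus: the
Navier–Stokes degree of an admissible budget for `𝒫` (degree `3`) must be at least `5`. Proof:
plant the seed `U` of `PalinstrophyWitness.lean` (`−∫⟪(U·∇)U, Δ²U⟫ > 0`) at scales `c = 8n` and
run the amplitude ray at `t₀ = (‖∇ΔU‖₂² + 1)/(−σ₂(U))` (`palinstrophy_rate_ray_le_budget`): the
initial rate is `t₀² c⁵`, the budget is `M c^{b−a+3e}`, and `exponent_le_of_forall_nat_mul_rpow_le`
gives `5 ≤ b − a + 3e`. In particular the Grönwall-closable `𝒫 · 𝒫^{1/3}` (degree `4`,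
`∫𝒫^{1/3} dt < ∞`, Foias–Guillopé–Temam) and `𝒫 · ℰ` (degree `4`) are excluded; the
Doering–Gibbon ladder law `𝒫^{5/3}` (degree `5`) sits on the boundary. Search for candidate a
priori estimates; no regularity claim. [folklore] -/
theorem not_isRateBudget_palinstrophy_monomial (a b e : ℝ) (habe : b - a + 3 * e < 5)
    (Cν : ℝ → ℝ) :
    ¬ IsRateBudget (d := Fin 3) (fun v => 2⁻¹ * ∫ x, ‖Torus.laplacian v x‖ ^ 2) (fun ν v =>
      Cν ν * Torus.kineticEnergy v ^ a * torusEnstrophy v ^ b *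
        (∫ x, ‖Torus.laplacian v x‖ ^ 2) ^ e) := by
  intro hB
  obtain ⟨U, hU, hUs, hdiv, hσ⟩ := BumpWitness.exists_compactSupport_divFree_production2_neg
  obtain ⟨q, hq⟩ : ∃ q : EuclideanSpace ℝ (Fin 3), ∀ i, q i = 1 / 2 :=
    ⟨WithLp.toLp 2 fun _ => 1 / 2, fun _ => rfl⟩
  obtain ⟨w, hw⟩ : ∃ w : ℕ → UnitAddTorus (Fin 3) → EuclideanSpace ℝ (Fin 3),
      ∀ n, w n = Torus.periodize fun y => (8 * n : ℝ) • U ((8 * n : ℝ) • (y + -q)) :=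
    ⟨_, fun n => rfl⟩
  set σU := ∫ z, ⟪fderiv ℝ U z (U z), Δ (Δ U) z⟫ with hσU
  set KU := ∫ z, ‖U z‖ ^ 2 with hKU
  set GU := ∫ z, ∑ i, ‖fderiv ℝ U z (EuclideanSpace.single i 1)‖ ^ 2 with hGU
  set DU := ∫ z, ‖Δ U z‖ ^ 2 with hDU
  set HU := ∫ z, ∑ i, ‖fderiv ℝ (Δ U) z (EuclideanSpace.single i 1)‖ ^ 2 with hHU
  have hKU0 : 0 ≤ KU := integral_nonneg fun _ => sq_nonneg _
  have hGU0 : 0 ≤ GU := integral_nonneg fun _ => Finset.sum_nonneg fun _ _ => sq_nonneg _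
  have hDU0 : 0 ≤ DU := integral_nonneg fun _ => sq_nonneg _
  have hHU0 : 0 ≤ HU := integral_nonneg fun _ => Finset.sum_nonneg fun _ _ => sq_nonneg _
  have hσ' : 0 < -σU := by linarith
  set t₀ : ℝ := (HU + 1) / (-σU) with ht₀
  have ht₀pos : 0 < t₀ := by positivity
  have ht₀σ : t₀ * (-σU) - HU = 1 := by
    rw [ht₀, div_mul_cancel₀ _ hσ'.ne']; ring
  set M : ℝ := Cν 1 * (t₀ ^ 2 * (2⁻¹ * KU)) ^ a * (t₀ ^ 2 * (2⁻¹ * GU)) ^ b * (t₀ ^ 2 * DU) ^ e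
    with hM
  have key : ∀ n : ℕ, 1 ≤ n →
      t₀ ^ 2 * 8 ^ (5 : ℝ) * (n : ℝ) ^ (5 : ℝ) ≤
        M * (8 : ℝ) ^ (b - a + 3 * e) * (n : ℝ) ^ (b - a + 3 * e) := by
    intro n hn
    have hn' : (1 : ℝ) ≤ n := by exact_mod_cast hn
    have hc8 : (8 : ℝ) ≤ 8 * n := by linarith
    have hc0 : (0 : ℝ) < 8 * n := by linarith
    obtain ⟨hsm, hdf, hzm, -, hEn, hDn⟩ := planted_facts hU hUs hdiv hq hc8
    have hKn := planted_kineticEnergy hUs hq hc8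
    obtain ⟨hσn, hHn⟩ := planted_facts2 hU hUs hq hc8
    rw [← hw n] at hsm hdf hzm hEn hDn hKn hσn hHn
    have hray := palinstrophy_rate_ray_le_budget hB (by simp) hsm hdf hzm t₀
    -- left side: `t₀³ c⁵ (−σU) − t₀² c⁵ HU = t₀² c⁵`
    have hL : t₀ ^ 3 * (-∫ x, ⟪Torus.convect (w n) (w n) x,
        Torus.laplacian (Torus.laplacian (w n)) x⟫) +
        t₀ ^ 2 * (-Torus.gradNormSq (Torus.laplacian (w n))) = t₀ ^ 2 * (8 * n : ℝ) ^ 5 := by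
      rw [hσn, hHn]
      have : t₀ ^ 3 * (-((8 * n : ℝ) ^ 5 * σU)) + t₀ ^ 2 * (-((8 * n : ℝ) ^ 5 * HU)) =
          t₀ ^ 2 * (8 * n : ℝ) ^ 5 * (t₀ * (-σU) - HU) := by ring
      rw [this, ht₀σ, mul_one]
    -- right side: the budget at `t₀ • w n`
    have hR : Cν 1 * Torus.kineticEnergy (t₀ • w n) ^ a * torusEnstrophy (t₀ • w n) ^ b *
        (∫ x, ‖Torus.laplacian (t₀ • w n) x‖ ^ 2) ^ e = M * (8 * n : ℝ) ^ (b - a + 3 * e) := by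
      have hw1 : Torus.IsContDiff 1 (w n) := hsm.isContDiff (n := 1) (WithTop.coe_le_coe.mpr le_top)
      rw [kineticEnergy_const_smul, torusEnstrophy_const_smul hw1, laplacianNormSq_const_smul hsm,
        hKn, hEn, hDn]
      have e1 : (t₀ ^ 2 * (2⁻¹ * ((8 * n : ℝ)⁻¹ * KU))) ^ a =
          (t₀ ^ 2 * (2⁻¹ * KU)) ^ a * (8 * n : ℝ) ^ (-a) := by
        rw [show t₀ ^ 2 * (2⁻¹ * ((8 * n : ℝ)⁻¹ * KU)) = (t₀ ^ 2 * (2⁻¹ * KU)) * (8 * n : ℝ)⁻¹ by ring,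
          Real.mul_rpow (by positivity) (by positivity), Real.inv_rpow hc0.le, Real.rpow_neg hc0.le]
      have e2 : (t₀ ^ 2 * (2⁻¹ * ((8 * n : ℝ) * GU))) ^ b =
          (t₀ ^ 2 * (2⁻¹ * GU)) ^ b * (8 * n : ℝ) ^ b := by
        rw [show t₀ ^ 2 * (2⁻¹ * ((8 * n : ℝ) * GU)) = (t₀ ^ 2 * (2⁻¹ * GU)) * (8 * n : ℝ) by ring,
          Real.mul_rpow (by positivity) hc0.le]
      have e3 : (t₀ ^ 2 * ((8 * n : ℝ) ^ 3 * DU)) ^ e =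
          (t₀ ^ 2 * DU) ^ e * (8 * n : ℝ) ^ (3 * e) := by
        rw [show t₀ ^ 2 * ((8 * n : ℝ) ^ 3 * DU) = (t₀ ^ 2 * DU) * (8 * n : ℝ) ^ 3 by ring,
          Real.mul_rpow (by positivity) (by positivity), ← Real.rpow_natCast (8 * n : ℝ) 3,
          ← Real.rpow_mul hc0.le]
        norm_num
      have e4 : (8 * n : ℝ) ^ (-a) * (8 * n : ℝ) ^ b * (8 * n : ℝ) ^ (3 * e) =
          (8 * n : ℝ) ^ (b - a + 3 * e) := by
        rw [← Real.rpow_add hc0, ← Real.rpow_add hc0]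
        congr 1
        ring
      rw [e1, e2, e3, hM, ← e4]
      ring
    have hineq : t₀ ^ 2 * (8 * n : ℝ) ^ 5 ≤ M * (8 * n : ℝ) ^ (b - a + 3 * e) := by
      rw [← hL, ← hR]; exact hray
    have h85 : (8 * n : ℝ) ^ 5 = (8 : ℝ) ^ (5 : ℝ) * (n : ℝ) ^ (5 : ℝ) := by
      rw [← Real.rpow_natCast (8 * n : ℝ) 5, Nat.cast_ofNat,
        Real.mul_rpow (by norm_num) (by positivity)]
    have h8r : (8 * n : ℝ) ^ (b - a + 3 * e) = (8 : ℝ) ^ (b - a + 3 * e) * (n : ℝ) ^ (b - a + 3 * e) :=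
      Real.mul_rpow (by norm_num) (by positivity)
    rw [h85, h8r, ← mul_assoc, ← mul_assoc] at hineq
    exact hineq
  have h5 := exponent_le_of_forall_nat_mul_rpow_le (by positivity) key
  linarith

/-- **The `K^a ℰ^b 𝒫^e`-free sub-class** (`e = 0`): for `b − a < 5` and every `C(ν)` the budget
`d/dt ½‖Δu‖₂² ≤ C(ν) K^a ℰ^b` fails on `T³`. [folklore] -/
theorem not_isRateBudget_palinstrophy_monomial_KE (a b : ℝ) (hab : b - a < 5) (Cν : ℝ → ℝ) :
    ¬ IsRateBudget (d := Fin 3) (fun v => 2⁻¹ * ∫ x, ‖Torus.laplacian v x‖ ^ 2) (fun ν v =>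
      Cν ν * Torus.kineticEnergy v ^ a * torusEnstrophy v ^ b) := by
  intro hB
  refine not_isRateBudget_palinstrophy_monomial a b 0 (by linarith) Cν (hB.mono fun ν _ v => ?_)
  rw [Real.rpow_zero, mul_one]

end Summit.NavierStokesRegularity.FunctionalMining

end
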